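import Literature.NumberTheory.Automorphic.UpqCasimirFormIdentity          -- ★ p834078 (A-p06 (g24)): T4a `re_form_upqPBasis_le`
import Literature.NumberTheory.Automorphic.UpqKInLieFormBound               -- ★-to-be (A-p06 (g24)): T4b-ii `norm_emb_ρ𝔤_le_of_mem_kInLie`
import Literature.NumberTheory.Automorphic.UpqTorusBoundOnPFiltration       -- ★-to-be p834609 (A-p06 (g24)): T4c-i `exists_norm_emb_torusGen_basis_le`
import Literature.NumberTheory.Automorphic.UpqCartanSplitBound              -- ★-to-be (A-p06 (g24)): T4c-ii-a `upq_exists_kInLie_add_sum_upqPBasis_bound`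
import Literature.Analysis.OperatorTheory.FiltrationFactorialBound          -- ★ p833677 (A-p06 (g24)): G2 `exists_rate_forall_exists_const`
import HarnessLib

/-!
# Brick «FB»: the degree bound G1 and the factorial bound (FB) for infinitesimally unitary `(𝔤, K)`-modules of `U(α, β)`

Topic `NumberTheory/Automorphic`; namespace `Literature.NumberTheory.Automorphic`; THEOREMS ONLY (no `def`, no named fact, no instance declaration, no notation,
no `sorry`).  Cell `hodgecm-mathlib`, F0∕P3, T1a arch line, ROAD-GLOB (A6 #92 `HasUnitaryGlobalizationOfInfUnitary` at `U(2,1)`; A-p14 (g24) ROAD v1 + LEAD F0P3b-p01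
(g3) v1.1 §1(a)): the brick «FB» = G1 + G2.  Data: a `(𝔤, K)`-module `(ρK, ρ𝔤)` of `U(α, β)` (★ `IsGKModule`); a positive definite Hermitian form `B` (★ G0
`IsPosDefHerm`; the `IsInfUnitary` form) for which every `ρ𝔤(Y)` is skew and `K` acts by isometries; the Casimir acting by a scalar `c` (Dixmier ★ N0 ∕ Schur);
a finite-dimensional `K`-stable `W₀` (a `K`-type) and its `𝔭`-filtration `F n = upqPFiltration ρ𝔤 W₀ n` (★ N1).  Norms: `‖emb ·‖ = √(Re B · ·)` (★ G0) on `V`,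
the `L^∞`-operator norm `‖(X : Matrix)‖` on `𝔤` (★ `GKModules` (H3)).
* **G1 `upq_degreeBound`** — `∃ a b ≥ 0`: (h1) `ρ𝔤(X) F n ⊆ F (n+1)` and (h2) `‖emb (ρ𝔤 X v)‖ ≤ ‖X‖ · (a + b n) · ‖emb v‖` for ALL `X ∈ 𝔤`, `v ∈ F n`
  (torus bound ★ T4c-i → K-BOUND ★ T4b-ii; 𝔭-letters via the Casimir ★ T4a; Cartan split with bounds ★ T4c-ii-a);
* **(FB) `upq_factorialBound`** — ★ G2 on top: `∃ K ≥ 0, ∀ v ∈ ⋃ F n, ∃ C, ∀ m (X : Fin m → 𝔤), ‖emb (ρ𝔤 X₀ ⋯ ρ𝔤 X_{m−1} v)‖ ≤ C · m! · K^m · ∏ ‖X_i‖`;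
  for an IRREDUCIBLE module and `W₀ ≠ ⊥` every `v` qualifies (★ `exists_mem_upqPFiltration`): **`upq_factorialBound_of_isIrreducibleGK`** = (FB) of v1.1 §1(a).
[HarishChandra1953, §9]; [Nelson1959, §2]; [KnappVogan1995, Thm. 0.6].
HONEST LABEL: closes no registered stub by itself (it is the hypothesis (FB) of the road's P1∕P2∕P3∕Φ).  HC_CM is proved only modulo the 2 remaining named inputs
(hLiu418, h413) until rung 0 closes.

## References
* Harish-Chandra, *Representations of a semisimple Lie group on a Banach space. I*, Trans. AMS 75 (1953), §9 [HarishChandra1953].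
* E. Nelson, *Analytic vectors*, Ann. of Math. 70 (1959), §2 [Nelson1959].
* A. W. Knapp, D. A. Vogan, *Cohomological Induction and Unitary Representations* (1995), Thm. 0.6 [KnappVogan1995].
-/

-- Mathlib idiom (as in ★ `GKModules`): the commutator bracket on `Module.End ℂ V`, to MENTION `ρ𝔤 : 𝔤 →ₗ⁅ℝ⁆ End V`.
attribute [local instance 100] LieRing.ofAssociativeRing

set_option autoImplicit false

noncomputable section

namespace Literature.NumberTheory.Automorphic

open Finset
open scoped Matrix ComplexConjugate Matrix.Norms.Operator
open Literature.RepresentationTheory.KonnoKonno2007 Literature.RepresentationTheory.KonnoKonno2007.RealDualPair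
open Literature.RepresentationTheory.BorelWallach2000
open Literature.Analysis.OperatorTheory

variable {α β : Type} [Fintype α] [DecidableEq α] [Fintype β] [DecidableEq β]
variable {V : Type*} [AddCommGroup V] [Module ℂ V]
  (ρK : Representation ℂ (uFormGroup α β).maximalCompact V) (ρ𝔤 : (uFormGroup α β).lie →ₗ⁅ℝ⁆ Module.End ℂ V)

/-! ## §1 Elementary inequalities -/

/-- `Σ x_a² ≤ (Σ x_a)²` for non-negative reals (private arithmetic helper). [folklore] -/
private theorem sum_sq_le_sq_sum_fb {ι : Type*} (s : Finset ι) (x : ι → ℝ) (hx : ∀ a ∈ s, 0 ≤ x a) :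
    ∑ a ∈ s, x a ^ 2 ≤ (∑ a ∈ s, x a) ^ 2 := by
  rw [sq, Finset.sum_mul]
  refine Finset.sum_le_sum fun a ha => ?_
  rw [sq]
  exact mul_le_mul_of_nonneg_left (Finset.single_le_sum hx ha) (hx a ha)

/-- `B u u = ‖emb u‖²` as a complex number. [cite: KnappVogan1995, Introduction (0.5)] -/
theorem form_self_eq_norm_emb_sq {B : V →ₗ⋆[ℂ] V →ₗ[ℂ] ℂ} (hB : IsPosDefHerm B) (u : V) : B u u = ((‖hB.emb u‖ ^ 2 : ℝ) : ℂ) := by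
  rw [← hB.inner_emb_emb, inner_self_eq_norm_sq_to_K]
  norm_cast

/-! ## §2 The `𝔭`-letters on `F n` -/

/-- **`𝔭`-letters**: if every `Y ∈ 𝔨` satisfies `‖emb (ρ𝔤 Y u)‖ ≤ κ ‖Y‖ R ‖emb u‖` at `u`, the Casimir is the scalar `c` at `u` and `ρ𝔤` is skew, then
`‖emb (ρ𝔤 x_s u)‖ ≤ (√‖c‖ + κ R Σ_a ‖w_a‖) ‖emb u‖` (★ T4a + `Σ x² ≤ (Σ x)²`). [cite: Nelson1959, §2] [cite: HarishChandra1953, §9] -/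
theorem norm_emb_upqPBasis_le {B : V →ₗ⋆[ℂ] V →ₗ[ℂ] ℂ} (hB : IsPosDefHerm B)
    (hskew : ∀ (Y : (uFormGroup α β).lie) (x y : V), B (ρ𝔤 Y x) y = -B x (ρ𝔤 Y y)) {c : ℂ} {u : V} (hc : upqCasimirOp ρ𝔤 u = c • u)
    {κ R : ℝ} (hκR : 0 ≤ κ * R)
    (hK : ∀ Y ∈ (uFormGroup α β).kInLie, ‖hB.emb (ρ𝔤 Y u)‖ ≤ κ * ‖(Y : Matrix (α ⊕ β) (α ⊕ β) ℂ)‖ * R * ‖hB.emb u‖) (s : (α × β) × Fin 2) :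
    ‖hB.emb (ρ𝔤 (upqPBasis s) u)‖ ≤
      (Real.sqrt ‖c‖ + κ * R * ∑ a, ‖((upqKVec α β a : (uFormGroup α β).lie) : Matrix (α ⊕ β) (α ⊕ β) ℂ)‖) * ‖hB.emb u‖ := by
  have h0 := re_form_upqPBasis_le ρ𝔤 B hB.re_nonneg hskew hc s
  -- rewrite every form-square as an `emb`-norm square
  rw [← hB.norm_emb_sq] at h0
  simp only [← hB.norm_emb_sq] at h0
  -- `−Re (c · B u u) ≤ ‖c‖ ‖emb u‖²`
  have hcterm : -(c * B u u).re ≤ ‖c‖ * ‖hB.emb u‖ ^ 2 := by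
    rw [form_self_eq_norm_emb_sq hB u, Complex.re_mul_ofReal]
    have h1 : -(c.re * ‖hB.emb u‖ ^ 2) ≤ |c.re| * ‖hB.emb u‖ ^ 2 := by
      rw [← neg_mul]; exact mul_le_mul_of_nonneg_right (neg_le_abs _) (sq_nonneg _)
    exact h1.trans (mul_le_mul_of_nonneg_right (Complex.abs_re_le_norm c) (sq_nonneg _))
  -- each `𝔨`-letter
  set W : ℝ := ∑ a, ‖((upqKVec α β a : (uFormGroup α β).lie) : Matrix (α ⊕ β) (α ⊕ β) ℂ)‖ with hW
  have hWnn : 0 ≤ W := Finset.sum_nonneg fun a _ => norm_nonneg _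
  have hka : ∀ a, ‖hB.emb (ρ𝔤 (upqKVec α β a) u)‖ ^ 2 ≤ (κ * ‖((upqKVec α β a : (uFormGroup α β).lie) : Matrix (α ⊕ β) (α ⊕ β) ℂ)‖ * R * ‖hB.emb u‖) ^ 2 :=
    fun a => pow_le_pow_left₀ (norm_nonneg _) (hK _ (upqKVec_mem a)) 2
  have hsumK : ∑ a, ‖hB.emb (ρ𝔤 (upqKVec α β a) u)‖ ^ 2 ≤ (κ * R * W * ‖hB.emb u‖) ^ 2 := by
    calc ∑ a, ‖hB.emb (ρ𝔤 (upqKVec α β a) u)‖ ^ 2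
        ≤ ∑ a, (κ * ‖((upqKVec α β a : (uFormGroup α β).lie) : Matrix (α ⊕ β) (α ⊕ β) ℂ)‖ * R * ‖hB.emb u‖) ^ 2 := Finset.sum_le_sum fun a _ => hka a
      _ = ∑ a, (κ * R * ‖hB.emb u‖ * ‖((upqKVec α β a : (uFormGroup α β).lie) : Matrix (α ⊕ β) (α ⊕ β) ℂ)‖) ^ 2 :=
          Finset.sum_congr rfl fun a _ => by ring
      _ ≤ (∑ a, κ * R * ‖hB.emb u‖ * ‖((upqKVec α β a : (uFormGroup α β).lie) : Matrix (α ⊕ β) (α ⊕ β) ℂ)‖) ^ 2 :=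
          sum_sq_le_sq_sum_fb _ _ fun a _ => mul_nonneg (mul_nonneg hκR (norm_nonneg _)) (norm_nonneg _)
      _ = (κ * R * W * ‖hB.emb u‖) ^ 2 := by rw [← Finset.mul_sum, hW]; ring
  -- assemble: `‖emb (ρ x_s u)‖² ≤ (√‖c‖ ‖emb u‖)² + (κ R W ‖emb u‖)² ≤ ((√‖c‖ + κ R W) ‖emb u‖)²`
  have hsq : ‖hB.emb (ρ𝔤 (upqPBasis s) u)‖ ^ 2 ≤ ((Real.sqrt ‖c‖ + κ * R * W) * ‖hB.emb u‖) ^ 2 := by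
    have h1 : ‖hB.emb (ρ𝔤 (upqPBasis s) u)‖ ^ 2 ≤ ‖c‖ * ‖hB.emb u‖ ^ 2 + (κ * R * W * ‖hB.emb u‖) ^ 2 := by linarith
    have h2 : ‖c‖ * ‖hB.emb u‖ ^ 2 = (Real.sqrt ‖c‖ * ‖hB.emb u‖) ^ 2 := by
      rw [mul_pow, Real.sq_sqrt (norm_nonneg _)]
    rw [h2] at h1
    have h3 : 0 ≤ Real.sqrt ‖c‖ * ‖hB.emb u‖ := mul_nonneg (Real.sqrt_nonneg _) (norm_nonneg _)
    have h4 : 0 ≤ κ * R * W * ‖hB.emb u‖ := mul_nonneg (mul_nonneg hκR hWnn) (norm_nonneg _)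
    nlinarith [h1, h3, h4, mul_nonneg h3 h4]
  have hnn : 0 ≤ (Real.sqrt ‖c‖ + κ * R * W) * ‖hB.emb u‖ := mul_nonneg (add_nonneg (Real.sqrt_nonneg _) (mul_nonneg hκR hWnn)) (norm_nonneg _)
  exact (sq_le_sq₀ (norm_nonneg _) hnn).mp hsq

/-! ## §3 G1: the degree bound (h1) + (h2) -/

/-- **G1 — THE DEGREE BOUND.**  There are `a, b ≥ 0` with (h1) `ρ𝔤(X) F n ⊆ F (n+1)` and (h2) `‖emb (ρ𝔤 X v)‖ ≤ ‖X‖ (a + b n) ‖emb v‖` for all `X ∈ 𝔤`, `n`, `v ∈ F n`.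
[cite: HarishChandra1953, §9] [cite: Nelson1959, §2] [cite: KnappVogan1995, Thm. 0.6] -/
theorem upq_degreeBound [Nonempty α] [Nonempty β] (hV : IsGKModule (uFormGroup α β) ρK ρ𝔤) {B : V →ₗ⋆[ℂ] V →ₗ[ℂ] ℂ} (hB : IsPosDefHerm B)
    (hskew : ∀ (Y : (uFormGroup α β).lie) (x y : V), B (ρ𝔤 Y x) y = -B x (ρ𝔤 Y y))
    (hKu : ∀ (k : (uFormGroup α β).maximalCompact) (x y : V), B (ρK k x) (ρK k y) = B x y)
    {c : ℂ} (hc : ∀ v : V, upqCasimirOp ρ𝔤 v = c • v)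
    (W₀ : Submodule ℂ V) [FiniteDimensional ℂ W₀] (hW₀ : ∀ (k : (uFormGroup α β).maximalCompact), ∀ w ∈ W₀, ρK k w ∈ W₀) :
    ∃ a b : ℝ, 0 ≤ a ∧ 0 ≤ b ∧
      (∀ (X : (uFormGroup α β).lie) (n : ℕ), ∀ v ∈ upqPFiltration ρ𝔤 W₀ n, ρ𝔤 X v ∈ upqPFiltration ρ𝔤 W₀ (n + 1)) ∧
      (∀ (X : (uFormGroup α β).lie) (n : ℕ), ∀ v ∈ upqPFiltration ρ𝔤 W₀ n,
        ‖hB.emb (ρ𝔤 X v)‖ ≤ ‖(X : Matrix (α ⊕ β) (α ⊕ β) ℂ)‖ * (a + b * n) * ‖hB.emb v‖) := by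
  -- the torus bound and the constants
  obtain ⟨r₀, hr₀, htor⟩ := exists_norm_emb_torusGen_basis_le ρK ρ𝔤 hV hB hskew W₀ hW₀
  set κ : ℝ := (Fintype.card α : ℝ) + Fintype.card β with hκ
  have hκnn : 0 ≤ κ := by positivity
  set W : ℝ := ∑ a, ‖((upqKVec α β a : (uFormGroup α β).lie) : Matrix (α ⊕ β) (α ⊕ β) ℂ)‖ with hW
  have hWnn : 0 ≤ W := Finset.sum_nonneg fun a _ => norm_nonneg _
  set P : ℝ := ∑ s : (α × β) × Fin 2, ‖((upqPBasis s : (uFormGroup α β).lie) : Matrix (α ⊕ β) (α ⊕ β) ℂ)‖ with hP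
  have hPnn : 0 ≤ P := Finset.sum_nonneg fun s _ => norm_nonneg _
  set N : ℝ := (Fintype.card ((α × β) × Fin 2) : ℝ) with hN
  -- K-BOUND at level `n`: `‖emb (ρ Y u)‖ ≤ κ ‖Y‖ (r₀+n) ‖emb u‖`
  have hK : ∀ (n : ℕ), ∀ Y ∈ (uFormGroup α β).kInLie, ∀ u ∈ upqPFiltration ρ𝔤 W₀ n,
      ‖hB.emb (ρ𝔤 Y u)‖ ≤ κ * ‖(Y : Matrix (α ⊕ β) (α ⊕ β) ℂ)‖ * (r₀ + n) * ‖hB.emb u‖ := by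
    intro n Y hY u hu
    exact norm_emb_ρ𝔤_le_of_mem_kInLie ρK ρ𝔤 hV hB hKu (fun k u hu => apply_mem_upqPFiltration_of_K_stable ρK hV hW₀ n k hu)
      (htor n).1 (htor n).2 Y hY hu
  -- 𝔭-letters at level `n`
  have hPlet : ∀ (n : ℕ) (s : (α × β) × Fin 2), ∀ u ∈ upqPFiltration ρ𝔤 W₀ n,
      ‖hB.emb (ρ𝔤 (upqPBasis s) u)‖ ≤ (Real.sqrt ‖c‖ + κ * (r₀ + n) * W) * ‖hB.emb u‖ := by
    intro n s u hu
    exact norm_emb_upqPBasis_le ρ𝔤 hB hskew (hc u) (mul_nonneg hκnn (by positivity)) (fun Y hY => hK n Y hY u hu) s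
  -- the constants
  refine ⟨κ * (1 + 2 * P) * r₀ + 2 * N * (Real.sqrt ‖c‖ + κ * r₀ * W), κ * (1 + 2 * P) + 2 * N * (κ * W), by positivity, by positivity, ?_, ?_⟩
  · -- (h1)
    intro X n v hv
    obtain ⟨k, hk, cf, hX, -, -⟩ := upq_exists_kInLie_add_sum_upqPBasis_bound X
    rw [hX, map_add, LinearMap.add_apply, map_sum, LinearMap.sum_apply]
    refine Submodule.add_mem _ ?_ (Submodule.sum_mem _ fun s _ => ?_)
    · exact monotone_upqPFiltration ρ𝔤 W₀ (Nat.le_succ n) (apply_mem_upqPFiltration_of_K_stable_of_mem_kInLie ρK hV hW₀ n hk hv)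
    · rw [map_smul]
      change ((cf s : ℝ) • ρ𝔤 (upqPBasis s)) v ∈ _
      rw [LinearMap.smul_apply]
      exact Submodule.smul_of_tower_mem _ _ (apply_upqPBasis_mem_upqPFiltration_succ s hv)
  · -- (h2)
    intro X n v hv
    obtain ⟨k, hk, cf, hX, hcf, hknorm⟩ := upq_exists_kInLie_add_sum_upqPBasis_bound X
    have hXnn : 0 ≤ ‖(X : Matrix (α ⊕ β) (α ⊕ β) ℂ)‖ := norm_nonneg _
    -- the `𝔨`-part
    have h1 : ‖hB.emb (ρ𝔤 k v)‖ ≤ κ * ((1 + 2 * P) * ‖(X : Matrix (α ⊕ β) (α ⊕ β) ℂ)‖) * (r₀ + n) * ‖hB.emb v‖ :=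
      (hK n k hk v hv).trans (by gcongr)
    -- the `𝔭`-part
    have h2 : ‖hB.emb (ρ𝔤 (∑ s, cf s • upqPBasis s) v)‖ ≤
        N * (2 * ‖(X : Matrix (α ⊕ β) (α ⊕ β) ℂ)‖ * ((Real.sqrt ‖c‖ + κ * (r₀ + n) * W) * ‖hB.emb v‖)) := by
      refine (norm_emb_ρ𝔤_sum_smul_le ρ𝔤 hB Finset.univ cf _ v).trans ?_
      calc ∑ s, |cf s| * ‖hB.emb (ρ𝔤 (upqPBasis s) v)‖
          ≤ ∑ _s : (α × β) × Fin 2, 2 * ‖(X : Matrix (α ⊕ β) (α ⊕ β) ℂ)‖ * ((Real.sqrt ‖c‖ + κ * (r₀ + n) * W) * ‖hB.emb v‖) :=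
            Finset.sum_le_sum fun s _ => mul_le_mul (hcf s) (hPlet n s v hv) (norm_nonneg _) (by positivity)
        _ = N * (2 * ‖(X : Matrix (α ⊕ β) (α ⊕ β) ℂ)‖ * ((Real.sqrt ‖c‖ + κ * (r₀ + n) * W) * ‖hB.emb v‖)) := by
            rw [Finset.sum_const, Finset.card_univ, nsmul_eq_mul]
    -- together
    have hsplit : ρ𝔤 X v = ρ𝔤 k v + ρ𝔤 (∑ s, cf s • upqPBasis s) v := by
      conv_lhs => rw [hX]
      rw [map_add, LinearMap.add_apply]
    rw [hsplit, map_add]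
    refine (norm_add_le _ _).trans ((add_le_add h1 h2).trans (le_of_eq ?_))
    ring

/-! ## §4 (FB): the factorial bound -/

/-- **(FB) along the filtration**: `∃ K ≥ 0, ∀ v ∈ ⋃ F n, ∃ C, ∀ m X, ‖emb (ρ𝔤 X₀ ⋯ ρ𝔤 X_{m−1} v)‖ ≤ C · m! · K^m · ∏ ‖X_i‖` (G1 + ★ G2).
[cite: HarishChandra1953, §9] [cite: Nelson1959, §2] [cite: KnappVogan1995, Thm. 0.6] -/
theorem upq_factorialBound [Nonempty α] [Nonempty β] (hV : IsGKModule (uFormGroup α β) ρK ρ𝔤) {B : V →ₗ⋆[ℂ] V →ₗ[ℂ] ℂ} (hB : IsPosDefHerm B)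
    (hskew : ∀ (Y : (uFormGroup α β).lie) (x y : V), B (ρ𝔤 Y x) y = -B x (ρ𝔤 Y y))
    (hKu : ∀ (k : (uFormGroup α β).maximalCompact) (x y : V), B (ρK k x) (ρK k y) = B x y)
    {c : ℂ} (hc : ∀ v : V, upqCasimirOp ρ𝔤 v = c • v)
    (W₀ : Submodule ℂ V) [FiniteDimensional ℂ W₀] (hW₀ : ∀ (k : (uFormGroup α β).maximalCompact), ∀ w ∈ W₀, ρK k w ∈ W₀) :
    ∃ K : ℝ, 0 ≤ K ∧ ∀ v : V, (∃ n, v ∈ upqPFiltration ρ𝔤 W₀ n) → ∃ C : ℝ, ∀ (m : ℕ) (X : Fin m → (uFormGroup α β).lie),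
      ‖hB.emb ((List.ofFn fun i => ρ𝔤 (X i)).prod v)‖ ≤ C * m.factorial * K ^ m * ∏ i, ‖((X i : (uFormGroup α β).lie) : Matrix (α ⊕ β) (α ⊕ β) ℂ)‖ := by
  obtain ⟨a, b, ha, hb, h1, h2⟩ := upq_degreeBound ρK ρ𝔤 hV hB hskew hKu hc W₀ hW₀
  exact exists_rate_forall_exists_const (fun X => ρ𝔤 X) (upqPFiltration ρ𝔤 W₀) (fun v => ‖hB.emb v‖)
    (fun X => ‖((X : (uFormGroup α β).lie) : Matrix (α ⊕ β) (α ⊕ β) ℂ)‖) (fun v => norm_nonneg _) (fun X => norm_nonneg _) ha hb h1 h2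

/-- **(FB) OF THE ROAD (v1.1 §1(a)) for an IRREDUCIBLE module**: with `W₀ ≠ ⊥` every vector lies in some `F n` (★ `exists_mem_upqPFiltration`), so
`∃ K ≥ 0, ∀ v, ∃ C, ∀ m X, ‖emb (ρ𝔤 X₀ ⋯ ρ𝔤 X_{m−1} v)‖ ≤ C · m! · K^m · ∏ ‖X_i‖`. [cite: HarishChandra1953, §9] [cite: KnappVogan1995, Thm. 0.6] -/
theorem upq_factorialBound_of_isIrreducibleGK [Nonempty α] [Nonempty β] (hV : IsGKModule (uFormGroup α β) ρK ρ𝔤) (hirr : IsIrreducibleGK ρK ρ𝔤)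
    {B : V →ₗ⋆[ℂ] V →ₗ[ℂ] ℂ} (hB : IsPosDefHerm B)
    (hskew : ∀ (Y : (uFormGroup α β).lie) (x y : V), B (ρ𝔤 Y x) y = -B x (ρ𝔤 Y y))
    (hKu : ∀ (k : (uFormGroup α β).maximalCompact) (x y : V), B (ρK k x) (ρK k y) = B x y)
    {c : ℂ} (hc : ∀ v : V, upqCasimirOp ρ𝔤 v = c • v)
    (W₀ : Submodule ℂ V) [FiniteDimensional ℂ W₀] (hW₀ : ∀ (k : (uFormGroup α β).maximalCompact), ∀ w ∈ W₀, ρK k w ∈ W₀) (hW₀ne : W₀ ≠ ⊥) :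
    ∃ K : ℝ, 0 ≤ K ∧ ∀ v : V, ∃ C : ℝ, ∀ (m : ℕ) (X : Fin m → (uFormGroup α β).lie),
      ‖hB.emb ((List.ofFn fun i => ρ𝔤 (X i)).prod v)‖ ≤ C * m.factorial * K ^ m * ∏ i, ‖((X i : (uFormGroup α β).lie) : Matrix (α ⊕ β) (α ⊕ β) ℂ)‖ := by
  obtain ⟨K, hK, h⟩ := upq_factorialBound ρK ρ𝔤 hV hB hskew hKu hc W₀ hW₀
  exact ⟨K, hK, fun v => h v (exists_mem_upqPFiltration ρK hV hirr hW₀ hW₀ne v)⟩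

end Literature.NumberTheory.Automorphic

end
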